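import Summits.KontsevichZagierPeriods.KontsevichZagierPeriods.Theses.LinRedNormalForm
import Literature.NumberTheory.Transcendental.KZCalculus
import Literature.NumberTheory.Transcendental.SemialgebraicMapsProofs
import Literature.NumberTheory.Transcendental.KZDominatedFamilyRelations
import Literature.NumberTheory.Transcendental.NashCubes

/-!
# `BeukersZeta3` (stmt-KontsevichZagierPeriods-3918, route LinRedNormalForm): charts and domains

Support file for the move chain proving the route item `LinRedNormalForm.BeukersZeta3`
(`Theorems/LinRedNormalFormBeukersZeta3.lean`): Beukers' `n = 0` integral
`[(0,1)³, 1/(1 − (1 − xy)z)]` is Kontsevich–Zagier equivalent to `[Δ₃, 2/(t₀t₁(1 − t₂))]`.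

* `chart_transport`, `polyChart_transport`: ONE change-of-variables move (Kontsevich–Zagier's
  rule (2)) along a semialgebraic, resp. polynomial, chart `C` injective on a semialgebraic `D`,
  packaged with the transport of absolute integrability in both directions
  (`MeasureTheory.integrableOn_image_iff_integrableOn_abs_det_fderiv_smul`); for a polynomial
  chart the Jacobian matrix is `(∂ⱼPᵢ)` (`fderiv_aeval_single`), so only its determinant has to
  be identified by hand. Pattern of `FurushoPentagon.HoffmanRelationInKZ.monomialChart_transport`,
  freed from the triangularity assumption.
* the domains of the chain (`ℚ`-semialgebraic: finite intersections of polynomial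
  inequalities), the partition `D₁ = A ⊔ B̄` and the null face `B̄ ∖ B ⊆ {u = x}`
  (`MeasureTheory.Measure.addHaar_submodule`);
* the three polynomial charts `Φ₁(x) = (1 − (1 − x₀x₁)x₂, x₀, x₁)`, `C₂(w) = (w₂w₀, w₂, w₁)`,
  `C₃(w) = (w₀, w₁, w₁w₂)`: values, Jacobian determinants (`Matrix.det_fin_three`), injectivity.

References: F. Beukers, *A note on the irrationality of ζ(2) and ζ(3)*, Bull. LMS 11 (1979), §2;
M. Kontsevich, D. Zagier, *Periods* (2001), §1.2; J. Bochnak, M. Coste, M.-F. Roy, *Real Algebraic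
Geometry* (1998), §2.1–2.2.
-/

noncomputable section

open Set MeasureTheory MvPolynomial
open Literature.NumberTheory.Transcendental
open Literature.ModelTheory.ExponentialFields (IsSemialgebraic isSemialgebraic_setOf_eval_lt
  isSemialgebraic_setOf_eval_le)

namespace Summit.KontsevichZagierPeriods.LinRedNormalForm.BeukersZeta3

/-! ## One change-of-variables move along a chart -/

/-- **Transport along a semialgebraic chart** (one KZ change-of-variables move, rule (2)). Let `C`
be `ℚ`-semialgebraic and injective on a `ℚ`-semialgebraic `D`, differentiable within `D` with
derivative `C'` of determinant `J` (`|J|` semialgebraic), and let `g = (h ∘ C) · |J|` on `D`. Then: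
(i) if some representation has domain `C '' D` and integrand `≡ h`, then `(D, g)` is a
representation; (ii) if some representation has domain `D` and integrand `≡ g`, then `h` is
absolutely integrable on `C '' D`; (iii) every representation `(D, ≡ g)` is KZ-equivalent to every
representation `(C '' D, ≡ h)`. [cite: KontsevichZagier2001, §1.2 rule (2)] -/
theorem chart_transport {N : ℕ} {D : Set (Fin N → ℝ)} (hD : IsSemialgebraic ℚ D)
    (C : (Fin N → ℝ) → (Fin N → ℝ)) (C' : (Fin N → ℝ) → (Fin N → ℝ) →L[ℝ] (Fin N → ℝ))
    (J : (Fin N → ℝ) → ℝ)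
    (hCsa : IsSemialgebraicMapOn ℚ D C) (hderiv : ∀ y ∈ D, HasFDerivWithinAt C (C' y) D y)
    (hdet : ∀ y ∈ D, (C' y).det = J y) (hJ : IsSemialgebraicFunOn ℚ D (fun y => |J y|))
    (hinj : InjOn C D) (g h : (Fin N → ℝ) → ℝ)
    (hgh : ∀ y ∈ D, g y = h (C y) * |J y|) :
    (∀ r' : KZ.IntegralRep N, r'.domain = C '' D → EqOn r'.integrand h r'.domain →
        ∃ r : KZ.IntegralRep N, r.domain = D ∧ r.integrand = g) ∧
    (∀ r : KZ.IntegralRep N, r.domain = D → EqOn r.integrand g D → IntegrableOn h (C '' D)) ∧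
    (∀ r r' : KZ.IntegralRep N, r.domain = D → EqOn r.integrand g D → r'.domain = C '' D →
        EqOn r'.integrand h r'.domain → KZ.Equivalent r r') := by
  have hDm : MeasurableSet D :=
    Literature.ModelTheory.ExponentialFields.IsSemialgebraic.measurableSet_holds hD
  refine ⟨?_, ?_, ?_⟩
  · intro r' hdom' hint'
    have hh : IsSemialgebraicFunOn ℚ (C '' D) h := by
      have := r'.isSemialgebraicFunOn_integrand.congr hint'
      rwa [hdom'] at this
    have hgsa : IsSemialgebraicFunOn ℚ D g :=
      (IsSemialgebraicFunOn.mul_holds (IsSemialgebraicFunOn.comp_isSemialgebraicMapOn_holds hh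
        hCsa (mapsTo_image C D)) hJ).congr fun y hy => by
          simp only [Pi.mul_apply, Function.comp_apply, hgh y hy]
    have hgi : IntegrableOn g D := by
      have h1 : IntegrableOn h (C '' D) := by
        have := r'.integrableOn.congr_fun hint' (KZ.IntegralRep.measurableSet_domain_holds r')
        rwa [hdom'] at this
      have h2 := (integrableOn_image_iff_integrableOn_abs_det_fderiv_smul volume hDm
        hderiv hinj h).mp h1
      refine h2.congr_fun (fun y hy => ?_) hDm
      show |(C' y).det| • h (C y) = g y
      rw [smul_eq_mul, mul_comm, hdet y hy, hgh y hy]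
    exact ⟨⟨D, g, hD, hgsa, hgi⟩, rfl, rfl⟩
  · intro r hdom hint
    have hgi : IntegrableOn g D := by
      have := r.integrableOn.congr_fun (hdom ▸ hint) (KZ.IntegralRep.measurableSet_domain_holds r)
      rwa [hdom] at this
    refine (integrableOn_image_iff_integrableOn_abs_det_fderiv_smul volume hDm hderiv hinj h).mpr ?_
    refine hgi.congr_fun (fun y hy => ?_) hDm
    show g y = |(C' y).det| • h (C y)
    rw [smul_eq_mul, mul_comm, hdet y hy, hgh y hy]
  · intro r r' hdom hint hdom' hint'
    refine KZ.changeOfVariablesRel_subset_relations ⟨N, r, r', C, C', hdom ▸ hCsa,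
      hdom ▸ hderiv, hdom ▸ hinj, by rw [hdom', hdom], fun y hy => ?_, rfl⟩
    rw [hdom] at hy
    have hy' : C y ∈ r'.domain := hdom' ▸ mem_image_of_mem C hy
    rw [hint hy, hint' hy', hdet y hy, hgh y hy]

/-- **Transport along a polynomial chart** `C(x) = (P₀(x), …, P_{N-1}(x))`, `Pᵢ ∈ ℚ[x]`: the chart
is `ℚ`-semialgebraic (`isSemialgebraicMapOn_aeval`) and everywhere differentiable with Jacobian
matrix `(∂ⱼPᵢ)` (`fderiv_aeval_single`), so `chart_transport` applies as soon as the Jacobian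
determinant is identified with a polynomial `J` on `D`, the chart is injective on `D`, and
`g = (h ∘ C)·|J|` there. [cite: KontsevichZagier2001, §1.2 rule (2)] -/
theorem polyChart_transport {N : ℕ} (P : Fin N → MvPolynomial (Fin N) ℚ)
    (J : MvPolynomial (Fin N) ℚ) {D : Set (Fin N → ℝ)} (hD : IsSemialgebraic ℚ D)
    (hJ : ∀ y ∈ D, (Matrix.of fun i j => aeval y (pderiv j (P i)) : Matrix (Fin N) (Fin N) ℝ).det
      = aeval y J)
    (hinj : InjOn (fun (x : Fin N → ℝ) (i : Fin N) => aeval x (P i)) D) (g h : (Fin N → ℝ) → ℝ)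
    (hgh : ∀ y ∈ D, g y = h (fun i => aeval y (P i)) * |aeval y J|) :
    (∀ r' : KZ.IntegralRep N, r'.domain = (fun (x : Fin N → ℝ) (i : Fin N) => aeval x (P i)) '' D →
        EqOn r'.integrand h r'.domain → ∃ r : KZ.IntegralRep N, r.domain = D ∧ r.integrand = g) ∧
    (∀ r : KZ.IntegralRep N, r.domain = D → EqOn r.integrand g D →
        IntegrableOn h ((fun (x : Fin N → ℝ) (i : Fin N) => aeval x (P i)) '' D)) ∧
    (∀ r r' : KZ.IntegralRep N, r.domain = D → EqOn r.integrand g D →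
        r'.domain = (fun (x : Fin N → ℝ) (i : Fin N) => aeval x (P i)) '' D →
        EqOn r'.integrand h r'.domain → KZ.Equivalent r r') := by
  set C : (Fin N → ℝ) → (Fin N → ℝ) := fun x i => aeval x (P i) with hC
  set C' : (Fin N → ℝ) → (Fin N → ℝ) →L[ℝ] (Fin N → ℝ) := fun y =>
    ContinuousLinearMap.pi fun i => fderiv ℝ (fun x : Fin N → ℝ => aeval x (P i)) y with hC'
  have hdiff : ∀ i, Differentiable ℝ (fun x : Fin N → ℝ => aeval x (P i)) := fun i =>
    (contDiff_aeval_real (n := 1) (P i)).differentiable one_ne_zero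
  have hderiv : ∀ y ∈ D, HasFDerivWithinAt C (C' y) D y := fun y _ =>
    (hasFDerivAt_pi.2 fun i => (hdiff i y).hasFDerivAt).hasFDerivWithinAt
  have hdet : ∀ y ∈ D, (C' y).det = aeval y J := by
    intro y hy
    have hM : LinearMap.toMatrix' (C' y : (Fin N → ℝ) →ₗ[ℝ] (Fin N → ℝ)) =
        Matrix.of fun i j => aeval y (pderiv j (P i)) := by
      ext i j
      rw [LinearMap.toMatrix'_apply, Matrix.of_apply]
      simp only [hC', ContinuousLinearMap.coe_coe, ContinuousLinearMap.pi_apply]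
      exact fderiv_aeval_single (P i) y j
    rw [ContinuousLinearMap.det, ← LinearMap.det_toMatrix', hM, hJ y hy]
  exact chart_transport hD C C' (fun y => aeval y J) (isSemialgebraicMapOn_aeval hD P) hderiv hdet
    (isSemialgebraicFunOn_aeval hD J).abs hinj g h hgh

/-! ## The domains

The sets of the chain, as local notations (coordinates `w = (u, x, y)` on the unfolded side,
`t` on the simplex side): `D1 = {0 < x, y < 1, xy < u < 1}`, `DA = {…, x < u < 1}`,
`DBc = {…, xy < u ≤ x}`, `DB = {…, xy < u < x}`, `DS` the open ordered simplex (spelled as in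
the route item), and the three polynomial charts `P1, P2, P3`. -/

local notation "D1" =>
  setOf (fun w : Fin 3 → ℝ => 0 < w 1 ∧ w 1 < 1 ∧ 0 < w 2 ∧ w 2 < 1 ∧ w 1 * w 2 < w 0 ∧ w 0 < 1)
local notation "DA" =>
  setOf (fun w : Fin 3 → ℝ => 0 < w 1 ∧ w 1 < 1 ∧ 0 < w 2 ∧ w 2 < 1 ∧ w 1 < w 0 ∧ w 0 < 1)
local notation "DBc" =>
  setOf (fun w : Fin 3 → ℝ => 0 < w 1 ∧ w 1 < 1 ∧ 0 < w 2 ∧ w 2 < 1 ∧ w 1 * w 2 < w 0 ∧ w 0 ≤ w 1)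
local notation "DB" =>
  setOf (fun w : Fin 3 → ℝ => 0 < w 1 ∧ w 1 < 1 ∧ 0 < w 2 ∧ w 2 < 1 ∧ w 1 * w 2 < w 0 ∧ w 0 < w 1)
local notation "DS" => setOf (fun t : Fin 3 → ℝ => 1 > t 0 ∧ t 0 > t 1 ∧ t 1 > t 2 ∧ t 2 > 0)
local notation "P1" => (![1 - (1 - X 0 * X 1) * X 2, X 0, X 1] : Fin 3 → MvPolynomial (Fin 3) ℚ)
local notation "P2" => (![X 2 * X 0, X 2, X 1] : Fin 3 → MvPolynomial (Fin 3) ℚ)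
local notation "P3" => (![X 0, X 1, X 1 * X 2] : Fin 3 → MvPolynomial (Fin 3) ℚ)

/-- A conjunction of six strict polynomial inequalities cuts out a `ℚ`-semialgebraic subset of
`ℝ³`. [cite: BochnakCosteRoy1998, Def. 2.1.4] -/
theorem isSemialgebraic_setOf_six_lt
    (p₁ q₁ p₂ q₂ p₃ q₃ p₄ q₄ p₅ q₅ p₆ q₆ : MvPolynomial (Fin 3) ℚ) :
    IsSemialgebraic ℚ {x : Fin 3 → ℝ | aeval x p₁ < aeval x q₁ ∧ aeval x p₂ < aeval x q₂ ∧
      aeval x p₃ < aeval x q₃ ∧ aeval x p₄ < aeval x q₄ ∧ aeval x p₅ < aeval x q₅ ∧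
      aeval x p₆ < aeval x q₆} := by
  have h := (((isSemialgebraic_setOf_eval_lt (R := ℝ) p₁ q₁).inter
    (isSemialgebraic_setOf_eval_lt p₂ q₂)).inter ((isSemialgebraic_setOf_eval_lt p₃ q₃).inter
    (isSemialgebraic_setOf_eval_lt p₄ q₄))).inter ((isSemialgebraic_setOf_eval_lt p₅ q₅).inter
    (isSemialgebraic_setOf_eval_lt p₆ q₆))
  have hset : {x : Fin 3 → ℝ | aeval x p₁ < aeval x q₁ ∧ aeval x p₂ < aeval x q₂ ∧
      aeval x p₃ < aeval x q₃ ∧ aeval x p₄ < aeval x q₄ ∧ aeval x p₅ < aeval x q₅ ∧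
      aeval x p₆ < aeval x q₆} = ({x : Fin 3 → ℝ | aeval x p₁ < aeval x q₁} ∩
      {x | aeval x p₂ < aeval x q₂} ∩ ({x | aeval x p₃ < aeval x q₃} ∩
      {x | aeval x p₄ < aeval x q₄})) ∩
      ({x | aeval x p₅ < aeval x q₅} ∩ {x | aeval x p₆ < aeval x q₆}) := by
    ext x
    simp only [mem_setOf_eq, mem_inter_iff, and_assoc]
  rw [hset]
  exact h

/-- The open unit cube `(0,1)³` is `ℚ`-semialgebraic. [folklore] -/
theorem isSemialgebraic_cube3 : IsSemialgebraic ℚ (openUnitCube 3) := isSemialgebraic_openUnitCube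

/-- `D₁ = {0 < x, y < 1, xy < u < 1}` is `ℚ`-semialgebraic. [folklore] -/
theorem isSemialgebraic_D1 : IsSemialgebraic ℚ D1 := by
  have h := isSemialgebraic_setOf_six_lt 0 (X 1) (X 1) 1 0 (X 2) (X 2) 1 (X 1 * X 2) (X 0) (X 0) 1
  simp only [map_zero, map_one, map_mul, aeval_X] at h
  exact h

/-- `A = {0 < x, y < 1, x < u < 1}` is `ℚ`-semialgebraic. [folklore] -/
theorem isSemialgebraic_DA : IsSemialgebraic ℚ DA := by
  have h := isSemialgebraic_setOf_six_lt 0 (X 1) (X 1) 1 0 (X 2) (X 2) 1 (X 1) (X 0) (X 0) 1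
  simp only [map_zero, map_one, aeval_X] at h
  exact h

/-- `B = {0 < x, y < 1, xy < u < x}` is `ℚ`-semialgebraic. [folklore] -/
theorem isSemialgebraic_DB : IsSemialgebraic ℚ DB := by
  have h := isSemialgebraic_setOf_six_lt 0 (X 1) (X 1) 1 0 (X 2) (X 2) 1 (X 1 * X 2) (X 0)
    (X 0) (X 1)
  simp only [map_zero, map_one, map_mul, aeval_X] at h
  exact h

/-- `B̄ = {0 < x, y < 1, xy < u ≤ x} = D₁ ∩ {u ≤ x}` is `ℚ`-semialgebraic. [folklore] -/
theorem isSemialgebraic_DBc : IsSemialgebraic ℚ DBc := by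
  have h := isSemialgebraic_D1.inter (isSemialgebraic_setOf_eval_le (k := ℚ) (R := ℝ)
    (X 0 : MvPolynomial (Fin 3) ℚ) (X 1))
  have hset : DBc = D1 ∩ {x : Fin 3 → ℝ | aeval x (X 0 : MvPolynomial (Fin 3) ℚ) ≤
      aeval x (X 1 : MvPolynomial (Fin 3) ℚ)} := by
    ext w
    simp only [mem_setOf_eq, mem_inter_iff, aeval_X]
    constructor
    · rintro ⟨h1, h2, h3, h4, h5, h6⟩
      exact ⟨⟨h1, h2, h3, h4, h5, by linarith⟩, h6⟩
    · rintro ⟨⟨h1, h2, h3, h4, h5, -⟩, h6⟩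
      exact ⟨h1, h2, h3, h4, h5, h6⟩
  rw [hset]
  exact h

/-- The open ordered simplex `1 > t₀ > t₁ > t₂ > 0` is `ℚ`-semialgebraic. [folklore] -/
theorem isSemialgebraic_DS : IsSemialgebraic ℚ DS := by
  have h := ((isSemialgebraic_setOf_eval_lt (k := ℚ) (R := ℝ) (X 0 : MvPolynomial (Fin 3) ℚ)
    1).inter (isSemialgebraic_setOf_eval_lt (X 1) (X 0))).inter
    ((isSemialgebraic_setOf_eval_lt (X 2) (X 1)).inter (isSemialgebraic_setOf_eval_lt 0 (X 2)))
  have hset : DS = ({x : Fin 3 → ℝ | aeval x (X 0 : MvPolynomial (Fin 3) ℚ) <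
      aeval x (1 : MvPolynomial (Fin 3) ℚ)} ∩
      {x | aeval x (X 1 : MvPolynomial (Fin 3) ℚ) < aeval x (X 0 : MvPolynomial (Fin 3) ℚ)}) ∩
      ({x | aeval x (X 2 : MvPolynomial (Fin 3) ℚ) < aeval x (X 1 : MvPolynomial (Fin 3) ℚ)} ∩
      {x | aeval x (0 : MvPolynomial (Fin 3) ℚ) < aeval x (X 2 : MvPolynomial (Fin 3) ℚ)}) := by
    ext w
    simp [and_assoc]
  rw [hset]
  exact h

/-! ## Set identities and the null face -/

/-- `D₁ = A ∪ B̄`. [folklore] -/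
theorem D1_eq_union : D1 = DA ∪ DBc := by
  ext w
  simp only [mem_setOf_eq, mem_union]
  constructor
  · rintro ⟨h1, h2, h3, h4, h5, h6⟩
    rcases lt_or_ge (w 1) (w 0) with h | h
    · exact Or.inl ⟨h1, h2, h3, h4, h, h6⟩
    · exact Or.inr ⟨h1, h2, h3, h4, h5, h⟩
  · rintro (⟨h1, h2, h3, h4, h5, h6⟩ | ⟨h1, h2, h3, h4, h5, h6⟩)
    · refine ⟨h1, h2, h3, h4, ?_, h6⟩
      have : w 1 * w 2 < w 1 := mul_lt_of_lt_one_right h1 h4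
      linarith
    · exact ⟨h1, h2, h3, h4, h5, by linarith⟩

/-- `A ∩ B̄ = ∅`. [folklore] -/
theorem DA_inter_DBc : DA ∩ DBc = ∅ := by
  ext w
  simp only [mem_inter_iff, mem_setOf_eq, mem_empty_iff_false, iff_false]
  rintro ⟨⟨-, -, -, -, h5, -⟩, ⟨-, -, -, -, -, h6⟩⟩
  exact absurd h5 (not_lt.mpr h6)

/-- `A ⊆ D₁`. [folklore] -/
theorem DA_subset_D1 : DA ⊆ D1 := by
  rw [D1_eq_union]; exact subset_union_left

/-- `B̄ ⊆ D₁`. [folklore] -/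
theorem DBc_subset_D1 : DBc ⊆ D1 := by
  rw [D1_eq_union]; exact subset_union_right

/-- `B ⊆ B̄`. [folklore] -/
theorem DB_subset_DBc : DB ⊆ DBc := by
  rintro w ⟨h1, h2, h3, h4, h5, h6⟩
  exact ⟨h1, h2, h3, h4, h5, h6.le⟩

/-- The hyperplane `{w₀ = w₁}` of `ℝ³` is Lebesgue-null (a proper linear subspace).
[folklore] -/
theorem volume_setOf_apply_zero_eq_apply_one : volume {w : Fin 3 → ℝ | w 0 = w 1} = 0 := by
  let L : (Fin 3 → ℝ) →ₗ[ℝ] ℝ :=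
    LinearMap.proj (R := ℝ) (φ := fun _ : Fin 3 => ℝ) 0 -
      LinearMap.proj (R := ℝ) (φ := fun _ : Fin 3 => ℝ) 1
  have hker : ({w : Fin 3 → ℝ | w 0 = w 1} : Set (Fin 3 → ℝ)) =
      ((LinearMap.ker L : Submodule ℝ (Fin 3 → ℝ)) : Set (Fin 3 → ℝ)) := by
    ext w
    simp [L, sub_eq_zero]
  have hne : LinearMap.ker L ≠ ⊤ := by
    intro h
    have : (Pi.single 0 1 : Fin 3 → ℝ) ∈ LinearMap.ker L := h ▸ Submodule.mem_top
    simp [L] at this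
  rw [hker]
  exact Measure.addHaar_submodule volume _ hne

/-- The face `B̄ ∖ B ⊆ {u = x}` is Lebesgue-null. [folklore] -/
theorem volume_DBc_diff_DB : volume (DBc \ DB) = 0 := by
  refine measure_mono_null ?_ volume_setOf_apply_zero_eq_apply_one
  rintro w ⟨⟨h1, h2, h3, h4, h5, h6⟩, hw⟩
  simp only [mem_setOf_eq, not_and, not_lt] at hw ⊢
  exact le_antisymm h6 (hw h1 h2 h3 h4 h5)

/-! ## The three polynomial charts: values, Jacobians, injectivity, images -/

/-- Values of the chart `Φ₁(x) = (1 − (1 − x₀x₁)x₂, x₀, x₁)`. [folklore] -/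
theorem chart1_apply (x : Fin 3 → ℝ) :
    (fun i => aeval x (P1 i)) = ![1 - (1 - x 0 * x 1) * x 2, x 0, x 1] := by
  funext i; fin_cases i <;> simp

/-- Values of the chart `C₂(w) = (w₂w₀, w₂, w₁)`. [folklore] -/
theorem chart2_apply (w : Fin 3 → ℝ) :
    (fun i => aeval w (P2 i)) = ![w 2 * w 0, w 2, w 1] := by
  funext i; fin_cases i <;> simp

/-- Values of the chart `C₃(w) = (w₀, w₁, w₁w₂)`. [folklore] -/
theorem chart3_apply (w : Fin 3 → ℝ) :
    (fun i => aeval w (P3 i)) = ![w 0, w 1, w 1 * w 2] := by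
  funext i; fin_cases i <;> simp

/-- Jacobian determinant of `Φ₁`: `x₀x₁ − 1`. [folklore] -/
theorem det_chart1 (y : Fin 3 → ℝ) :
    (Matrix.of fun i j => aeval y (pderiv j (P1 i)) : Matrix (Fin 3) (Fin 3) ℝ).det
      = aeval y (X 0 * X 1 - 1 : MvPolynomial (Fin 3) ℚ) := by
  simp [Matrix.det_fin_three]

/-- Jacobian determinant of `C₂`: `−w₂`. [folklore] -/
theorem det_chart2 (y : Fin 3 → ℝ) :
    (Matrix.of fun i j => aeval y (pderiv j (P2 i)) : Matrix (Fin 3) (Fin 3) ℝ).det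
      = aeval y (-X 2 : MvPolynomial (Fin 3) ℚ) := by
  simp [Matrix.det_fin_three]

/-- Jacobian determinant of `C₃`: `w₁`. [folklore] -/
theorem det_chart3 (y : Fin 3 → ℝ) :
    (Matrix.of fun i j => aeval y (pderiv j (P3 i)) : Matrix (Fin 3) (Fin 3) ℝ).det
      = aeval y (X 1 : MvPolynomial (Fin 3) ℚ) := by
  simp [Matrix.det_fin_three]

/-- `Φ₁` is injective on the open cube. [folklore] -/
theorem injOn_chart1 :
    InjOn (fun (x : Fin 3 → ℝ) (i : Fin 3) => aeval x (P1 i)) (openUnitCube 3) := by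
  intro x hx x' _ h
  have h0 : aeval x (P1 0) = aeval x' (P1 0) := congrFun h 0
  have h1 : aeval x (P1 1) = aeval x' (P1 1) := congrFun h 1
  have h2 : aeval x (P1 2) = aeval x' (P1 2) := congrFun h 2
  simp only [Matrix.cons_val_zero, Matrix.cons_val_one, Matrix.cons_val_two, Matrix.head_cons,
    Matrix.tail_cons, map_sub, map_mul, map_one, aeval_X] at h0 h1 h2
  have hlt : x 0 * x 1 < 1 := by
    have := mul_lt_of_lt_one_right (hx 0).1 (hx 1).2
    linarith [(hx 0).2]
  rw [← h1, ← h2] at h0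
  have hx2 : x 2 = x' 2 := by
    have hne : (1 - x 0 * x 1) ≠ 0 := by linarith
    have : (1 - x 0 * x 1) * x 2 = (1 - x 0 * x 1) * x' 2 := by linarith
    exact mul_left_cancel₀ hne this
  funext i
  fin_cases i
  · exact h1
  · exact h2
  · exact hx2

/-- `C₂` is injective on `A`. [folklore] -/
theorem injOn_chart2 : InjOn (fun (x : Fin 3 → ℝ) (i : Fin 3) => aeval x (P2 i)) DA := by
  intro x hx x' _ h
  have h0 : aeval x (P2 0) = aeval x' (P2 0) := congrFun h 0
  have h1 : aeval x (P2 1) = aeval x' (P2 1) := congrFun h 1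
  have h2 : aeval x (P2 2) = aeval x' (P2 2) := congrFun h 2
  simp only [Matrix.cons_val_zero, Matrix.cons_val_one, Matrix.cons_val_two, Matrix.head_cons,
    Matrix.tail_cons, map_mul, aeval_X] at h0 h1 h2
  obtain ⟨-, -, h3, -, -, -⟩ := hx
  rw [← h1] at h0
  have hx0 : x 0 = x' 0 := mul_left_cancel₀ h3.ne' h0
  funext i
  fin_cases i
  · exact hx0
  · exact h2
  · exact h1

/-- `C₃` is injective on `A`. [folklore] -/
theorem injOn_chart3 : InjOn (fun (x : Fin 3 → ℝ) (i : Fin 3) => aeval x (P3 i)) DA := by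
  intro x hx x' _ h
  have h0 : aeval x (P3 0) = aeval x' (P3 0) := congrFun h 0
  have h1 : aeval x (P3 1) = aeval x' (P3 1) := congrFun h 1
  have h2 : aeval x (P3 2) = aeval x' (P3 2) := congrFun h 2
  simp only [Matrix.cons_val_zero, Matrix.cons_val_one, Matrix.cons_val_two, Matrix.head_cons,
    Matrix.tail_cons, map_mul, aeval_X] at h0 h1 h2
  obtain ⟨h3, -, -, -, -, -⟩ := hx
  rw [← h1] at h2
  have hx2 : x 2 = x' 2 := mul_left_cancel₀ h3.ne' h2
  funext i
  fin_cases i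
  · exact h0
  · exact h1
  · exact hx2

end Summit.KontsevichZagierPeriods.LinRedNormalForm.BeukersZeta3
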